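import Literature.Probability.LatticeModels.GaussianFieldCouplingPositivity
import Literature.Probability.LatticeModels.ReflectionPositivityExtensionCountable
import HarnessLib

/-!
# Reflection positivity of Gaussian lattice fields on ALL bounded observables

Theorem-only file (no definitions, no named facts).  For the centred Gaussian field `μ = N(0, K)` on `V → ℝ` of a positive-semidefinite
kernel `K` (the tree's `gaussianFieldOfKernel`), a site map `θ : V → V` which is an involution leaving `K` invariant, and a «positive half»
`P ⊆ V` on which the REFLECTED kernel is positive semidefinite — `0 ≤ Σ_{i,j} c_i c_j K(θ z_i, z_j)` for finite families `z_i ∈ P` — the measure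
`μ` is REFLECTION POSITIVE in the sense of the tree (`IsReflectionPositive μ θ P`, FILS 1978 §2 ∕ Biskup 2009 Def. 5.2: ALL bounded
observables measurable in the coordinates in `P`), which is the hypothesis `rp` of the Osterwalder–Schrader reconstruction
`Literature.Probability.LatticeModels.IsRPMeasureData` ∕ `OSReconstructionLattice.isRPMeasureData_lattice`.  This is Glimm–Jaffe's Thm. 6.2.2
(reflection positivity of Gaussian measures ⇔ reflection positivity of the covariance) in lattice form; the proof here goes through the
COUPLING of `GaussianFieldCouplingPositivity.lean` for bounded LOCAL observables (`gaussianField_integral_mul_reflect_nonneg`) and the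
«local ⇒ global» closure of `ReflectionPositivityExtensionCountable.lean` (`gaussianField_isReflectionPositive`, countable `V`), instead of
the density of the exponential algebra.

## References

* J. Glimm, A. Jaffe, *Quantum Physics* (2nd ed. 1987), §6.2 Thm. 6.2.2, §6.3. [GlimmJaffe1987]
* J. Fröhlich, R. Israel, E. H. Lieb, B. Simon, Comm. Math. Phys. 62 (1978) 1–34, §2–3. [FILS1978]
* M. Biskup, LNM 1970 (2009), §5.1 Def. 5.2 (and Lemma 5.6, Gaussian∕quadratic interactions). [Biskup2009]
-/

noncomputable section

open MeasureTheory ProbabilityTheory Finset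
open scoped BigOperators

universe u

namespace Literature.Probability.LatticeModels

open Literature.MathematicalPhysics.QuantumFieldTheory (IsPosSemidefKernel gaussianFieldOfKernel isProbabilityMeasure_gaussianFieldOfKernel)

section GaussianRP

variable {V : Type u} [DecidableEq V]

omit [DecidableEq V] in
/-- The σ-algebra of the coordinates in a finite window is contained in the pull-back of the product σ-algebra along the restriction.
[cite: Biskup2009, §5.1 (the local algebras)] -/
private theorem cylinderEvents_finset_le_comap_restrict {S : Type*} [MeasurableSpace S] (W : Finset V) :
    cylinderEvents (X := fun _ : V => S) ↑W ≤ MeasurableSpace.comap W.restrict MeasurableSpace.pi := by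
  refine iSup₂_le fun i hi => ?_
  have : (fun σ : V → S => σ i) = (fun η : ↥W → S => η ⟨i, hi⟩) ∘ W.restrict := rfl
  rw [this, ← MeasurableSpace.comap_comp]
  exact MeasurableSpace.comap_mono (measurable_pi_apply _).comap_le

/-- **A window-measurable real observable only sees the window**: `G σ = G(σ·𝟙_W)` (extension by `0` off `W`) for `G` measurable in the
coordinates in `W` (Doob's factorisation, Mathlib `Measurable.factorsThrough`). [cite: Biskup2009, §5.1 (local observables)] -/
theorem apply_eq_apply_extend_of_measurable_cylinderEvents (W : Finset V) {G : (V → ℝ) → ℝ}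
    (hG : Measurable[cylinderEvents (X := fun _ : V => ℝ) ↑W] G) (σ : V → ℝ) :
    G σ = G (fun v => if v ∈ W then σ v else 0) := by
  have hfac := (hG.mono (cylinderEvents_finset_le_comap_restrict W) le_rfl).factorsThrough
  refine hfac ?_
  funext w
  simp [w.2]

/-- Extension by zero `ℝ^W → ℝ^V` is measurable. [cite: Biskup2009, §5.1 (local observables)] -/
theorem measurable_extendByZero (W : Finset V) :
    Measurable fun (y : ↥W → ℝ) (v : V) => if h : v ∈ W then y ⟨v, h⟩ else 0 := by
  refine measurable_pi_lambda _ fun v => ?_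
  by_cases h : v ∈ W
  · simp only [h, dite_true]; exact measurable_pi_apply _
  · simp only [h, dite_false]; exact measurable_const

/-- ★★ **REFLECTION POSITIVITY OF A GAUSSIAN FIELD ON BOUNDED LOCAL OBSERVABLES.**  Let `K` be a positive-semidefinite kernel on `V`, `θ` an
involution of `V` leaving `K` invariant, and `P ⊆ V` a half on which the reflected kernel is positive semidefinite:
`0 ≤ Σ_{i,j∈s} c_i c_j K(θ z_i, z_j)` for all finite families `z_i ∈ P`.  Then for every finite window `W ⊆ P` and every BOUNDED real observable `G`
measurable in the coordinates in `W`, `0 ≤ ∫ G(σ ∘ θ) G(σ) dN(0,K)(σ)`.  Proof: the pair `(σ|_W, (σ∘θ)|_W)` is the centred Gaussian vector with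
covariance `[[A,R],[R,A]]`, `A = K|_W`, `R = K(θ·,·)|_W ⪰ 0`, `A − R ⪰ 0` (positivity of `K` on the family `W ∪ θW` with coefficients
`(x, −x)`), so the coupling positivity `E[g(Y)g(X)] = E_Z[(E_U g(Z+U))²] ≥ 0` applies. [cite: GlimmJaffe1987, §6.2 Thm. 6.2.2] [cite: FILS1978, §3] -/
theorem gaussianField_integral_mul_reflect_nonneg {K : V → V → ℝ} (hK : IsPosSemidefKernel K) {θ : V → V}
    (hθK : ∀ a b, K (θ a) (θ b) = K a b) (hθ : Function.Involutive θ) {P : Set V}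
    (hRP : ∀ (ι : Type u) (s : Finset ι) (c : ι → ℝ) (z : ι → V), (∀ i ∈ s, z i ∈ P) →
      0 ≤ ∑ i ∈ s, ∑ j ∈ s, c i * c j * K (θ (z i)) (z j))
    (W : Finset V) (hW : (↑W : Set V) ⊆ P) {G : (V → ℝ) → ℝ} (hG : Measurable[cylinderEvents (X := fun _ : V => ℝ) ↑W] G)
    {C : ℝ} (hGb : ∀ σ, |G σ| ≤ C) :
    0 ≤ ∫ σ, G (fun v => σ (θ v)) * G σ ∂gaussianFieldOfKernel K := by
  classical
  haveI := isProbabilityMeasure_gaussianFieldOfKernel hK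
  have hKsymm : ∀ a b, K a b = K b a := isPosSemidefKernel_symm hK
  -- symmetry of the reflected kernel
  have hRsymm : ∀ a b : V, K (θ a) b = K (θ b) a := fun a b => by
    rw [hKsymm (θ a) b, ← hθK b (θ a), hθ a]
  -- the window kernels
  set A : ↥W → ↥W → ℝ := fun a b => K a b with hA
  set R : ↥W → ↥W → ℝ := fun a b => K (θ a) b with hR
  have hWP : ∀ a : ↥W, (a : V) ∈ P := fun a => hW a.2
  have hRpsd : IsPosSemidefKernel R := by
    refine isPosSemidefKernel_of_sum_sum_nonneg (fun a b => hRsymm _ _) fun I x => ?_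
    have h := hRP (↥I) Finset.univ x (fun v => ((v : ↥W) : V)) fun v _ => hWP _
    simpa [hR] using h
  have hDpsd : IsPosSemidefKernel fun a b => A a b - R a b := by
    refine isPosSemidefKernel_of_sum_sum_nonneg (fun a b => by simp only [hA, hR]; rw [hKsymm, hRsymm]) fun I x => ?_
    -- positivity of `K` on the family `W ∪ θW` with coefficients `(x, −x)`
    have h := isPosSemidefKernel_sum_sum_nonneg hK (Finset.univ : Finset (↥I ⊕ ↥I)) (Sum.elim x fun v => -x v)
      (Sum.elim (fun v => ((v : ↥W) : V)) fun v => θ ((v : ↥W) : V))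
    simp only [Fintype.sum_sum_type, Sum.elim_inl, Sum.elim_inr, Finset.sum_add_distrib] at h
    have hcross : ∑ v : ↥I, ∑ w : ↥I, x v * -x w * K ((v : ↥W) : V) (θ ((w : ↥W) : V))
        = ∑ v : ↥I, ∑ w : ↥I, x v * -x w * K (θ ((v : ↥W) : V)) ((w : ↥W) : V) := by
      rw [Finset.sum_comm]
      refine Finset.sum_congr rfl fun v _ => Finset.sum_congr rfl fun w _ => ?_
      rw [hKsymm ((w : ↥W) : V) (θ (v : ↥W))]
      ring
    have hθθ : ∑ v : ↥I, ∑ w : ↥I, -x v * -x w * K (θ ((v : ↥W) : V)) (θ ((w : ↥W) : V))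
        = ∑ v : ↥I, ∑ w : ↥I, x v * x w * K ((v : ↥W) : V) ((w : ↥W) : V) := by
      refine Finset.sum_congr rfl fun v _ => Finset.sum_congr rfl fun w _ => ?_
      rw [hθK]; ring
    rw [hcross, hθθ] at h
    have e1 : ∑ v : ↥I, ∑ w : ↥I, x v * -x w * K (θ ((v : ↥W) : V)) ((w : ↥W) : V)
        = -∑ v : ↥I, ∑ w : ↥I, x v * x w * K (θ ((v : ↥W) : V)) ((w : ↥W) : V) := by
      rw [← Finset.sum_neg_distrib]; refine Finset.sum_congr rfl fun v _ => ?_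
      rw [← Finset.sum_neg_distrib]; refine Finset.sum_congr rfl fun w _ => ?_; ring
    have e2 : ∑ v : ↥I, ∑ w : ↥I, -x v * x w * K (θ ((v : ↥W) : V)) ((w : ↥W) : V)
        = -∑ v : ↥I, ∑ w : ↥I, x v * x w * K (θ ((v : ↥W) : V)) ((w : ↥W) : V) := by
      rw [← Finset.sum_neg_distrib]; refine Finset.sum_congr rfl fun v _ => ?_
      rw [← Finset.sum_neg_distrib]; refine Finset.sum_congr rfl fun w _ => ?_; ring
    rw [e1, e2] at h
    have key : ∑ v : ↥I, ∑ w : ↥I, x v * x w * (A v w - R v w)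
        = (∑ v : ↥I, ∑ w : ↥I, x v * x w * K ((v : ↥W) : V) ((w : ↥W) : V))
          - ∑ v : ↥I, ∑ w : ↥I, x v * x w * K (θ ((v : ↥W) : V)) ((w : ↥W) : V) := by
      simp only [hA, hR, mul_sub, Finset.sum_sub_distrib]
    rw [key]
    linarith
  -- the joint kernel on `W ⊕ W` is the re-indexed kernel along `site = (id on W, θ on W)`
  have hjoint : (fun j j' : ↥W ⊕ ↥W => K (Sum.elim (fun w : ↥W => (w : V)) (fun w : ↥W => θ (w : V)) j)
        (Sum.elim (fun w : ↥W => (w : V)) (fun w : ↥W => θ (w : V)) j'))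
      = fun j j' : ↥W ⊕ ↥W => Sum.elim (fun a => Sum.elim (A a) (R a) j') (fun a => Sum.elim (R a) (A a) j') j := by
    funext j j'
    rcases j with a | a <;> rcases j' with b | b <;> simp only [Sum.elim_inl, Sum.elim_inr, hA, hR]
    all_goals first | exact hθK _ _ | exact (hKsymm _ _).trans (hRsymm _ _)
  -- the law of `(σ|_W, (σ∘θ)|_W)`
  have hT : Measurable fun (σ : V → ℝ) (j : ↥W ⊕ ↥W) => σ (Sum.elim (fun w : ↥W => (w : V)) (fun w : ↥W => θ (w : V)) j) :=
    measurable_pi_lambda _ fun j => measurable_pi_apply _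
  have hlaw := gaussianFieldOfKernel_map_precomp hK (Sum.elim (fun w : ↥W => (w : V)) (fun w : ↥W => θ (w : V)))
  rw [hjoint] at hlaw
  -- factor `G` through the window
  set g : (↥W → ℝ) → ℝ := fun y => G (fun v => if h : v ∈ W then y ⟨v, h⟩ else 0) with hg
  have hgm : Measurable g := (hG.mono cylinderEvents_le_pi le_rfl).comp (measurable_extendByZero W)
  have hgb : ∀ y, |g y| ≤ C := fun y => hGb _
  have hfac : ∀ σ : V → ℝ, G σ = g (fun w : ↥W => σ w) := fun σ =>
    (apply_eq_apply_extend_of_measurable_cylinderEvents W hG σ).trans rfl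
  have hm1 : Measurable fun (x : ↥W ⊕ ↥W → ℝ) (a : ↥W) => x (Sum.inr a) := measurable_pi_lambda _ fun a => measurable_pi_apply (Sum.inr a)
  have hm2 : Measurable fun (x : ↥W ⊕ ↥W → ℝ) (a : ↥W) => x (Sum.inl a) := measurable_pi_lambda _ fun a => measurable_pi_apply (Sum.inl a)
  have hFm : Measurable fun x : ↥W ⊕ ↥W → ℝ => g (fun a => x (Sum.inr a)) * g (fun a => x (Sum.inl a)) :=
    (hgm.comp hm1).mul (hgm.comp hm2)
  have hcomp : ∫ σ, G (fun v => σ (θ v)) * G σ ∂gaussianFieldOfKernel K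
      = ∫ x, g (fun a => x (Sum.inr a)) * g (fun a => x (Sum.inl a))
          ∂(gaussianFieldOfKernel K).map (fun (σ : V → ℝ) (j : ↥W ⊕ ↥W) => σ (Sum.elim (fun w : ↥W => (w : V)) (fun w : ↥W => θ (w : V)) j)) := by
    rw [integral_map hT.aemeasurable hFm.aestronglyMeasurable]
    refine integral_congr_ae (ae_of_all _ fun σ => ?_)
    simp only [Sum.elim_inr, Sum.elim_inl]
    rw [hfac (fun v => σ (θ v)), hfac σ]
  rw [hcomp, hlaw]
  exact integral_mul_nonneg_of_coupling hRpsd hDpsd hgm hgb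

/-- The Gaussian field of a `θ`-invariant kernel is invariant under the configuration reflection `σ ↦ σ ∘ θ`. [cite: GlimmJaffe1987, §6.2 Thm. 6.2.2] -/
theorem gaussianField_isReflectionInvariant {K : V → V → ℝ} (hK : IsPosSemidefKernel K) (θ : V ≃ V) (hθK : ∀ a b, K (θ a) (θ b) = K a b) :
    IsReflectionInvariant (gaussianFieldOfKernel K) θ := by
  unfold IsReflectionInvariant
  have h := gaussianFieldOfKernel_map_precomp hK θ
  have hK' : (fun j j' => K (θ j) (θ j')) = K := funext fun a => funext fun b => hθK a b
  rw [hK'] at h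
  exact h

/-- ★★★ **REFLECTION POSITIVITY OF GAUSSIAN LATTICE FIELDS ON ALL BOUNDED OBSERVABLES** (Glimm–Jaffe Thm. 6.2.2, lattice form): over a COUNTABLE
index set `V`, if the involution `θ` leaves the positive-semidefinite kernel `K` invariant and the reflected kernel `K(θ·,·)` is positive
semidefinite along finite families in the half `P`, then `N(0,K)` is reflection positive with respect to `θ` and `P` in the tree's sense
`IsReflectionPositive` — `0 ≤ Re ∫ conj(F(σ∘θ)) F(σ) dN(0,K)` for EVERY bounded complex observable `F` measurable in the coordinates in `P`.
(Bounded local observables by the coupling; all bounded ones by the martingale closure `isReflectionPositive_of_local_bdd`.)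
[cite: GlimmJaffe1987, §6.2 Thm. 6.2.2] [cite: FILS1978, §3] [cite: Biskup2009, §5.1 Def. 5.2, Lemma 5.6] -/
theorem gaussianField_isReflectionPositive [Countable V] {K : V → V → ℝ} (hK : IsPosSemidefKernel K) (θ : V ≃ V)
    (hθK : ∀ a b, K (θ a) (θ b) = K a b) (hθ : Function.Involutive θ) {P : Set V}
    (hRP : ∀ (ι : Type u) (s : Finset ι) (c : ι → ℝ) (z : ι → V), (∀ i ∈ s, z i ∈ P) →
      0 ≤ ∑ i ∈ s, ∑ j ∈ s, c i * c j * K (θ (z i)) (z j)) :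
    IsReflectionPositive (gaussianFieldOfKernel K) θ P := by
  haveI := isProbabilityMeasure_gaussianFieldOfKernel hK
  refine isReflectionPositive_of_local_bdd (gaussianField_isReflectionInvariant hK θ hθK) fun W hW G hG hGb => ?_
  obtain ⟨C, hC⟩ := hGb
  exact gaussianField_integral_mul_reflect_nonneg hK hθK hθ hRP W hW hG hC

/-- The real form `IsReflectionPositiveReal` under the same hypotheses. [cite: GlimmJaffe1987, §6.2 Thm. 6.2.2] [cite: Biskup2009, §5.1 Def. 5.2] -/
theorem gaussianField_isReflectionPositiveReal [Countable V] {K : V → V → ℝ} (hK : IsPosSemidefKernel K) (θ : V ≃ V)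
    (hθK : ∀ a b, K (θ a) (θ b) = K a b) (hθ : Function.Involutive θ) {P : Set V}
    (hRP : ∀ (ι : Type u) (s : Finset ι) (c : ι → ℝ) (z : ι → V), (∀ i ∈ s, z i ∈ P) →
      0 ≤ ∑ i ∈ s, ∑ j ∈ s, c i * c j * K (θ (z i)) (z j)) :
    IsReflectionPositiveReal (gaussianFieldOfKernel K) θ P := by
  haveI := isProbabilityMeasure_gaussianFieldOfKernel hK
  refine isReflectionPositiveReal_of_local_bdd (gaussianField_isReflectionInvariant hK θ hθK) fun W hW G hG hGb => ?_
  obtain ⟨C, hC⟩ := hGb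
  exact gaussianField_integral_mul_reflect_nonneg hK hθK hθ hRP W hW hG hC

end GaussianRP

end Literature.Probability.LatticeModels
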